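import Summits.BirchSwinnertonDyer.BirchSwinnertonDyer.Theorems.ErratumRoadFiveNonSurjCornerOfRouteItems
import HarnessLib

/-!
# Route `ErratumRoadFive` (rung K2), crux `NonSurjCorner` (item stmt-BirchSwinnertonDyer-19065): THE PHASE-1b GLUE OF RULING 66 (e), PROVED MODULO
# SEVEN TOP-LEVEL ROUTE ITEMS — `NonSurjCornerKolyZ → NonSurjCornerTwinMuAn → ‹KatoTwinFactsFiveAnContra› → NonSurjCorner`
# (cell `bsd-stepL`, seat `bsd-stepL-corner-p1` g18; `--supports stmt-BirchSwinnertonDyer-19065 --as helper`; the planner's resplit of 19065 consumes it)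

WHY THIS FILE. RULING 66 (e) (planner g41, 2026-08-28T14:06:32Z) fixes the shape of the re-split of 19065 forced by the route's items cap: the corner
`NonSurjCorner` is re-split into the children {`NonSurjCornerKolyZ` (19946), `NonSurjCornerTwinMuAn` (19948), `KatoTwinFactsFiveAnContra` (new support
child; text = the FIFTEEN twin ∕ MAX facts of r14–r17 slot 3 VERBATIM)} with the generated glue item
`NonSurjCornerOfItems : NonSurjCornerKolyZ → NonSurjCornerTwinMuAn → KatoTwinFactsFiveAnContra → NonSurjCorner`, and asks this seat for the glue's
proof MODULO the seven top-level items it genuinely consumes, in the binder order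
`(h₅ : PublishedInputsFive) (h₃ : X11aLowerHalf) (hF2 : EulerHalfGrossPrintFacts) (hJL : ShimuraParametrizationDataNonempty)
(hCO : PastenComponentOrdersInput) (hCTi : ShimuraCasselsTateLevelInputs) (hLab : ShimuraCarrierLabelsB6FromFive)`.
This file is exactly that: g17's ten-item composition `nonSurjCorner_of_routeItems` (p639164) RE-CUT to the glue shape. Because the child
`KatoTwinFactsFiveAnContra` and the glue decl `NonSurjCornerOfItems` are not yet declared in `Theses/ErratumRoadFive.lean` (rev 52), the conclusion is
SPELLED OUT — the three children's texts in glue order, the Kato child written as its fifteen-conjunct body — so the statement elaborates today and is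
definitionally equal to `NonSurjCornerOfItems` the moment the resplit lands (both new decls are plain `def … : Prop`); the by-name one-liner
`… : NonSurjCornerOfItems := nonSurjCornerOfItems_holds h₅ h₃ hF2 hJL hCO hCTi hLab` then closes the glue item `--workitem`.
* **`nonSurjCornerOfItems_holds : PublishedInputsFive → X11aLowerHalf → EulerHalfGrossPrintFacts → ShimuraParametrizationDataNonempty →
  PastenComponentOrdersInput → ShimuraCasselsTateLevelInputs → ShimuraCarrierLabelsB6FromFive →
  (NonSurjCornerKolyZ → NonSurjCornerTwinMuAn → ‹fifteen twin facts› → NonSurjCorner)`**.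
Mathematics: none new — glue #19′ (`…HybridLabelsOnlyX11aByName`) through p639164; see that file for the slot-by-slot account (p-anchor + parity: no
structural residual; Cha's upper fact, Poitou–Tate for Selmer structures and the CM primitives derived inside; INDEX-FREE LAB ⟹ slot 6 via
`EulerHalfLABIndexGuard.carrierLabelsB6AtFive_of_indexFree` at `p ∈ {5,7}`).

HONEST FRAMING: ONE THEOREM (no definition, no named fact, no `sorry`); CONDITIONAL on seven route items (OPEN mathematics in 19064 and in the (B6) item
27982; printed inputs elsewhere) and, inside the glue statement, on the children 19946 (deep Kolyvagin certificates a fortiori; beyond print), 19948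
(analytic μ = 0 at the leaf twins; per pair decidable) and the fifteen cite-only twin facts; item 19065 is NOT closed by this file (the resplit and the
close are registry acts of the planner); nothing about any curve's BSD; BSD is not advanced; T7.
References (locators only): [cite: PastenShimura2024, Prop. 6.13, Lemma 6.18] [cite: Jetchev2008, Thm. 1.1, Cor. 1.5] [cite: Cha2005, Thm. 21, Rmk. 25]
[cite: Kato2004Asterisque, Thm. 12.4, §17.13] [cite: GrossLMS1991, §3 Prop. 3.7 (2)] [cite: CaiShuTian2014, Thm. 1.5] [cite: Miller2011LMS, Def. 1.1].
-/

set_option autoImplicit false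
set_option linter.dupNamespace false -- `Summit.BirchSwinnertonDyer.BirchSwinnertonDyer` (summit = problem), tree-wide

noncomputable section

open scoped Classical NumberField MatrixGroups ModularForm

namespace Summit.BirchSwinnertonDyer.BirchSwinnertonDyer.Theorems

open CongruenceSubgroup WeierstrassCurve NumberField IsDedekindDomain Field Rat.HeightOneSpectrum
  Literature.NumberTheory.EllipticCurves
  Literature.NumberTheory.EllipticCurves.ModularForms
  Literature.NumberTheory.Automorphic
  Literature.NumberTheory.EllipticCurves.Rank1Residual
  Literature.NumberTheory.EllipticCurves.Rank1Residual.Typed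
  Literature.NumberTheory.GaloisRepresentations Literature.NumberTheory.GaloisCohomology
  Summit.BirchSwinnertonDyer.Rank1Residual
  Summit.BirchSwinnertonDyer.Rank1Residual.X11b
  Summit.BirchSwinnertonDyer.Rank1Residual.X11b.Three.Koly
  Summit.BirchSwinnertonDyer.BirchSwinnertonDyer.Theses.ErratumRoadFive

/-- **The phase-1b glue `NonSurjCornerOfItems` of RULING 66 (e), modulo the seven top-level items it consumes** (binder order as ruled):
from `PublishedInputsFive` (19066), `X11aLowerHalf` (19064), `EulerHalfGrossPrintFacts` (27981), `ShimuraParametrizationDataNonempty` (19524),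
`PastenComponentOrdersInput` (19716), `ShimuraCasselsTateLevelInputs` (20191), `ShimuraCarrierLabelsB6FromFive` (27982), the implication
`NonSurjCornerKolyZ → NonSurjCornerTwinMuAn → ‹KatoTwinFactsFiveAnContra, spelled out: the fifteen twin ∕ MAX facts› → NonSurjCorner` — the glue
statement of the re-split with its not-yet-declared decls unfolded (definitionally the by-name glue once filed). Proof: g17's `nonSurjCorner_of_routeItems`
(p639164) with the binders re-ordered. CONDITIONAL; 19065 NOT closed by this file; T7.
[cite: PastenShimura2024, Lemma 6.18] [cite: Jetchev2008, Thm. 1.1 and Cor. 1.5] [cite: Cha2005, Thm. 21 and Rmk. 25] [cite: Miller2011LMS, Def. 1.1] -/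
theorem nonSurjCornerOfItems_holds
    (h₅ : PublishedInputsFive) (h₃ : X11aLowerHalf) (hF2 : EulerHalfGrossPrintFacts)
    (hJL : ShimuraParametrizationDataNonempty) (hCO : PastenComponentOrdersInput) (hCTi : ShimuraCasselsTateLevelInputs)
    (hLab : ShimuraCarrierLabelsB6FromFive) :
    NonSurjCornerKolyZ → NonSurjCornerTwinMuAn →
    -- `KatoTwinFactsFiveAnContra` (RULING 56 ∕ 66 (e): the fifteen twin ∕ MAX facts = r14–r17 slot 3 VERBATIM), spelled out until the child is filed
    ((∀ (N : ℕ) [NeZero N] (W : WeierstrassCurve ℚ) (K : Type) [Field K] [NumberField K], Literature.NumberTheory.EllipticCurves.gross_zagier N W K) ∧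
      (∀ (N : ℕ) [NeZero N] (W : WeierstrassCurve ℚ) (K : Type) [Field K] [NumberField K], Literature.NumberTheory.EllipticCurves.kolyvagin N W K) ∧
      Literature.NumberTheory.EllipticCurves.Wuthrich2014.sha_dvd_analyticSha ∧
      Literature.NumberTheory.EllipticCurves.rank_eq_analyticRank_of_analyticRank_le_one ∧
      Literature.NumberTheory.EllipticCurves.ModularForms.exists_isNewformOf ∧
      Literature.NumberTheory.EllipticCurves.friedbergHoffstein_exists_heegnerField_split_twist_ne_zero ∧
      Literature.NumberTheory.EllipticCurves.ModularForms.mazur_not_dvd_maninConstant_of_odd ∧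
      Literature.NumberTheory.EllipticCurves.SteinWuthrich2013.thm61_splitMultiplicative ∧
      Literature.NumberTheory.EllipticCurves.SteinWuthrich2013.thm61_nonsplitMultiplicative ∧
      (∀ (W : WeierstrassCurve ℚ) [W.IsElliptic] [W.IsGloballyMinimal] (p : ℕ) [Fact p.Prime], Literature.NumberTheory.EllipticCurves.greenberg_stevens (W := W) (p := p)) ∧
      Literature.NumberTheory.EllipticCurves.Cha2005.rmk25_pow_dvd_card_sha_primary_of_certificate ∧
      Literature.NumberTheory.EllipticCurves.Kato2004.thm12_4 ∧
      Literature.NumberTheory.EllipticCurves.Kato2004.exists_multDivisibilityInputs_nonsplit_contra ∧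
      Literature.NumberTheory.EllipticCurves.Kato2004.exists_multDivisibilityInputs_split_contra ∧
      Literature.NumberTheory.EllipticCurves.Kato2004.exists_multDivisibilityInputs_fine_contra) →
    NonSurjCorner :=
  fun hZ hμ hF ↦ nonSurjCorner_of_routeItems hZ hμ h₅ hF h₃ hF2 hJL hCO hCTi hLab

end Summit.BirchSwinnertonDyer.BirchSwinnertonDyer.Theorems

end
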